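import Literature.NumberTheory.EllipticCurves.KodairaNeronSplitHenselianProofs
import HarnessLib

/-!
# Kodaira–Néron for split multiplicative reduction over a Henselian ring: `E(K)/E₀(K)` is cyclic

Second `Proofs` companion of `Literature/NumberTheory/EllipticCurves/KodairaNeron.lean` for its
named fact `WeierstrassCurve.index_goodReductionSubgroup_of_hasSplitMultiplicativeReduction`
(Silverman, *ATAEC*, Cor. IV.9.2(d) with (b), PDF p. 340: over a discrete valuation ring that
is "complete, or even merely Henselian", "if `E` has split multiplicative reduction, then
`E(K)/E₀(K)` is a cyclic group of order `−v(j(E))`"; *AEC* Thm. VII.6.1).  The order half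
`[E(K) : E₀(K)] = v(Δ)` is `KodairaNeronSplitHenselianProofs.lean`; this file proves the
**cyclicity** of `E(K)/E₀(K)` and assembles the discharge
`WeierstrassCurve.index_goodReductionSubgroup_of_hasSplitMultiplicativeReduction_holds`
(no hypothesis on the residue field is used).

## Proof

On the Tate normal form `J : y² + xy = x³ + απⁿ` (`α ∈ Rˣ`, `n = v(Δ) ≥ 1`) of the minimal
equation over the Henselian ring (`exists_variableChange_eq_tateNormalForm`), the quotient
`G = J(K)/J₀(K)` has order `n` (`LocalIndex.index_eq_of_tateNormalForm`).  For `n ≤ 2` there is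
nothing to prove.  For `n ≥ 3` the class `g` of the bad point `Q₁ = (π, πz)` (`z ∈ 𝔪`,
`LocalIndex.exists_repQ`) has order `n`, so `G` is cyclic: by explicit chord-and-tangent
computations (`LocalIndex.two_smul_shape`, `LocalIndex.add_repQ_shape`) the multiple `k • Q₁`
is, for `2 ≤ k < n/2`, an integral point `(πᵏu, πᵏut)` with `u ∈ Rˣ`, `t ∈ 𝔪` — in the
language of the Tate curve `E_q(K) ≅ K*/qᶻ` (Silverman, *ATAEC*, V.4, Lemma 4.1.2) the `k`-th
power of a uniformiser lies in the piece `U_k`, `v(x) = k` — hence reduces to the node, so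
`k • g ≠ 0` for `2k < n`; `(n/2) • g ≠ 0` by the chord/tangent test of
`KodairaNeronSplitHenselianProofs`; and `k • g = −(n − k) • g ≠ 0` for `n/2 < k < n` because
`n • g = 0`.  Cyclicity is transported back along the `R`-isomorphism `I ≅ J`
(`LocalIndex.isAddCyclic_quotient_smul_iff`).  This replaces the identification of
`E(K)/E₀(K)` with the component group `ℤ/nℤ` of the Néron `n`-gon in the printed proof
(Tate's algorithm, *ATAEC* IV.9.4, type `Iₙ`) by an elementary generator.

## References

* J. H. Silverman, *Advanced Topics in the Arithmetic of Elliptic Curves*, GTM 151, Springer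
  1994: Cor. IV.9.2(b),(d) and Remark 9.2.1 (PDF p. 340); V.4, Lemmas 4.1.1–4.1.4
  (PDF pp. 402–405). [SilvermanATAEC1994]
* J. H. Silverman, *The Arithmetic of Elliptic Curves*, 2nd ed., GTM 106, Springer 2009,
  Thm. VII.6.1. [SilvermanAEC2009]
-/

noncomputable section

open scoped Classical

open IsLocalRing

namespace Literature.NumberTheory.EllipticCurves

namespace LocalIndex

open DiophantineGeometry DiophantineGeometry.TateAlgorithm

variable {R : Type*} [CommRing R] [IsDomain R] [IsDiscreteValuationRing R]
  {K : Type*} [Field K] [Algebra R K] [IsFractionRing R K]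

/-! ### Chord and tangent in coordinates on `y² + xy = x³ + a₆` -/

omit [IsDomain R] [IsDiscreteValuationRing R] [IsFractionRing R K] in
/-- **Addition in coordinates.** On `J : y² + xy + a₃y = x³ + a₄x + a₆` (`a₁ = 1`, `a₂ = 0`,
`a₃ = 0`), if the line through two integral points `P₁ = (x₁, y₁)`, `P₂ = (x₂, y₂)` with
`P₁ + P₂ ≠ 𝒪` has slope `λ ∈ R`, then `P₁ + P₂ = (x₃, y₃)` with `x₃ = λ² + λ − x₁ − x₂` and
`y₃ = −(λ(x₃ − x₁) + y₁) − x₃` (Silverman, *AEC*, III.2.3). [folklore] -/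
theorem add_eq_some_of_slope_eq (J : WeierstrassCurve R) (h1 : J.a₁ = 1) (h2 : J.a₂ = 0)
    (h3 : J.a₃ = 0) {x₁ y₁ x₂ y₂ ℓ : R}
    (h₁ : (J.baseChange K).toAffine.Nonsingular (algebraMap R K x₁) (algebraMap R K y₁))
    (h₂ : (J.baseChange K).toAffine.Nonsingular (algebraMap R K x₂) (algebraMap R K y₂))
    (hxy : ¬(algebraMap R K x₁ = algebraMap R K x₂ ∧ algebraMap R K y₁ =
      (J.baseChange K).toAffine.negY (algebraMap R K x₂) (algebraMap R K y₂)))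
    (hslope : (J.baseChange K).toAffine.slope (algebraMap R K x₁) (algebraMap R K x₂)
      (algebraMap R K y₁) (algebraMap R K y₂) = algebraMap R K ℓ) :
    ∃ h₃ : (J.baseChange K).toAffine.Nonsingular (algebraMap R K (ℓ ^ 2 + ℓ - x₁ - x₂))
        (algebraMap R K (-(ℓ * (ℓ ^ 2 + ℓ - x₁ - x₂ - x₁) + y₁) - (ℓ ^ 2 + ℓ - x₁ - x₂))),
      WeierstrassCurve.Affine.Point.some _ _ h₁ + WeierstrassCurve.Affine.Point.some _ _ h₂ =
        WeierstrassCurve.Affine.Point.some _ _ h₃ := by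
  set x₃ : R := ℓ ^ 2 + ℓ - x₁ - x₂ with hx₃
  set y₃ : R := -(ℓ * (x₃ - x₁) + y₁) - x₃ with hy₃
  have hX : (J.baseChange K).toAffine.addX (algebraMap R K x₁) (algebraMap R K x₂)
      ((J.baseChange K).toAffine.slope (algebraMap R K x₁) (algebraMap R K x₂)
        (algebraMap R K y₁) (algebraMap R K y₂)) = algebraMap R K x₃ := by
    rw [hslope, WeierstrassCurve.Affine.addX]
    simp [WeierstrassCurve.baseChange, h1, h2, hx₃]
  have hY : (J.baseChange K).toAffine.addY (algebraMap R K x₁) (algebraMap R K x₂)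
      (algebraMap R K y₁)
      ((J.baseChange K).toAffine.slope (algebraMap R K x₁) (algebraMap R K x₂)
        (algebraMap R K y₁) (algebraMap R K y₂)) = algebraMap R K y₃ := by
    rw [WeierstrassCurve.Affine.addY, WeierstrassCurve.Affine.negAddY, hX, hslope,
      WeierstrassCurve.Affine.negY]
    simp [WeierstrassCurve.baseChange, h1, h3, hy₃]
  refine ⟨?_, ?_⟩
  · have h := WeierstrassCurve.Affine.nonsingular_add h₁ h₂ hxy
    rwa [hX, hY] at h
  · rw [WeierstrassCurve.Affine.Point.add_some hxy]
    exact point_some_congr hX hY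

/-- **Slope of a chord.** If `x₁ − x₂ = c·d` and `y₁ − y₂ = c·e` with `c ≠ 0` and `d d' = 1`, then
`x₁ ≠ x₂` and the chord through `(x₁, y₁)`, `(x₂, y₂)` has slope `λ = e d' ∈ R`. [folklore] -/
theorem slope_eq_of_sub_eq (J : WeierstrassCurve R) {x₁ y₁ x₂ y₂ c d d' e : R} (hc : c ≠ 0)
    (hd : d * d' = 1) (hX : x₁ - x₂ = c * d) (hY : y₁ - y₂ = c * e) :
    algebraMap R K x₁ ≠ algebraMap R K x₂ ∧
      (J.baseChange K).toAffine.slope (algebraMap R K x₁) (algebraMap R K x₂)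
        (algebraMap R K y₁) (algebraMap R K y₂) = algebraMap R K (e * d') := by
  have hinj := IsFractionRing.injective R K
  have hd0 : d ≠ 0 := fun h => by rw [h, zero_mul] at hd; exact zero_ne_one hd
  have hne : algebraMap R K x₁ ≠ algebraMap R K x₂ := by
    intro h
    have h0 : x₁ - x₂ = 0 := sub_eq_zero.mpr (hinj h)
    rw [hX] at h0
    exact mul_ne_zero hc hd0 h0
  refine ⟨hne, ?_⟩
  rw [WeierstrassCurve.Affine.slope_of_X_ne hne, ← map_sub, ← map_sub, hX, hY,
    div_eq_iff ((map_ne_zero_iff _ hinj).mpr (mul_ne_zero hc hd0)), ← map_mul]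
  congr 1
  linear_combination (-(c * e)) * hd

/-- **Slope of a tangent** on `y² + xy = x³ + a₆`: if `2y + x = c·d` and `3x² − y = c·e` with
`c ≠ 0` and `d d' = 1`, then `(x, y)` is not `2`-torsion and the tangent has slope
`λ = e d' ∈ R`. [folklore] -/
theorem slope_eq_of_tangent (J : WeierstrassCurve R) (h1 : J.a₁ = 1) (h2 : J.a₂ = 0)
    (h3 : J.a₃ = 0) (h4 : J.a₄ = 0) {x y c d d' e : R} (hc : c ≠ 0) (hd : d * d' = 1)
    (hD : 2 * y + x = c * d) (hN : 3 * x ^ 2 - y = c * e) :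
    algebraMap R K y ≠ (J.baseChange K).toAffine.negY (algebraMap R K x) (algebraMap R K y) ∧
      (J.baseChange K).toAffine.slope (algebraMap R K x) (algebraMap R K x)
        (algebraMap R K y) (algebraMap R K y) = algebraMap R K (e * d') := by
  have hinj := IsFractionRing.injective R K
  have hd0 : d ≠ 0 := fun h => by rw [h, zero_mul] at hd; exact zero_ne_one hd
  have hnegY : (J.baseChange K).toAffine.negY (algebraMap R K x) (algebraMap R K y) =
      algebraMap R K (-y - x) := by
    rw [WeierstrassCurve.Affine.negY]
    simp [WeierstrassCurve.baseChange, h1, h3]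
  have hyne : algebraMap R K y ≠
      (J.baseChange K).toAffine.negY (algebraMap R K x) (algebraMap R K y) := by
    rw [hnegY]
    intro h'
    have h0 : 2 * y + x = 0 := by linear_combination hinj h'
    rw [hD] at h0
    exact mul_ne_zero hc hd0 h0
  refine ⟨hyne, ?_⟩
  rw [WeierstrassCurve.Affine.slope_of_Y_ne rfl hyne, hnegY]
  have hnum : 3 * algebraMap R K x ^ 2 + 2 * (J.baseChange K).toAffine.a₂ * algebraMap R K x +
      (J.baseChange K).toAffine.a₄ - (J.baseChange K).toAffine.a₁ * algebraMap R K y =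
        algebraMap R K (3 * x ^ 2 - y) := by
    simp [WeierstrassCurve.baseChange, h1, h2, h4, map_ofNat]
  have hden : algebraMap R K y - algebraMap R K (-y - x) = algebraMap R K (2 * y + x) := by
    rw [← map_sub]; congr 1; ring
  rw [hnum, hden, hN, hD,
    div_eq_iff ((map_ne_zero_iff _ hinj).mpr (mul_ne_zero hc hd0)), ← map_mul]
  congr 1
  linear_combination (-(c * e)) * hd

/-! ### The multiples of `Q₁ = (π, πz)` on the Tate normal form -/

section TateNormalForm

variable (J : WeierstrassCurve R) {ϖ α : R} {n : ℕ}

/-- **`2Q₁` lies in the piece `v(x) = 2`, branch `0`.** On `J : y² + xy = x³ + απⁿ` with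
`n ≥ 5`, for the bad point `Q₁ = (π, πz)` (`z ∈ 𝔪`; then `z² + z = π + απⁿ⁻²`):
`2Q₁ = (π²u, π²ut)` with `u ∈ Rˣ`, `t ∈ 𝔪`.  Indeed the tangent has slope
`λ = (3π − z)/(2z + 1) ∈ 𝔪`, `(2z + 1)²·x(2Q₁) = π²(1 − απⁿ⁻⁴ − 8απⁿ⁻³)` and
`y(2Q₁) = −x(2Q₁)(λ + 1) + π(λ − z)` with `λ − z = π(1 − 2απⁿ⁻³)/(2z + 1)`
(cf. Silverman, *ATAEC*, V.4, Lemma 4.1.2: `v(x(u²)) = 2` on the Tate curve). [folklore] -/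
theorem two_smul_shape (hϖ : Irreducible ϖ) (h1 : J.a₁ = 1) (h2 : J.a₂ = 0) (h3 : J.a₃ = 0)
    (h4 : J.a₄ = 0) (h6 : J.a₆ = α * ϖ ^ n) (hn : 5 ≤ n) {z : R} (hz : z ∈ maximalIdeal R)
    (hQ : (J.baseChange K).toAffine.Nonsingular (algebraMap R K ϖ) (algebraMap R K (ϖ * z))) :
    ∃ (u t : R) (h : (J.baseChange K).toAffine.Nonsingular (algebraMap R K (ϖ ^ 2 * u))
        (algebraMap R K (ϖ ^ 2 * u * t))), IsUnit u ∧ t ∈ maximalIdeal R ∧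
      WeierstrassCurve.Affine.Point.some _ _ hQ + WeierstrassCurve.Affine.Point.some _ _ hQ =
        WeierstrassCurve.Affine.Point.some _ _ h := by
  have hinj := IsFractionRing.injective R K
  have hϖ0 : ϖ ≠ 0 := hϖ.ne_zero
  obtain ⟨d, rfl⟩ : ∃ d, n = d + 5 := ⟨n - 5, by omega⟩
  have hres0 : residue R ϖ = 0 := residue_uniformizer_eq_zero hϖ
  have hrz : residue R z = 0 := (residue_eq_zero_iff _).mpr hz
  -- the equation of `Q₁`: `z² + z = ϖ + α ϖ^(d+3)`
  have he : J.toAffine.Equation ϖ (ϖ * z) :=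
    (WeierstrassCurve.Affine.map_equation _ hinj _ _).mp hQ.left
  rw [WeierstrassCurve.Affine.equation_iff, h1, h2, h3, h4, h6] at he
  have hz' : z ^ 2 + z = ϖ + α * ϖ ^ (d + 3) :=
    mul_left_cancel₀ (pow_ne_zero 2 hϖ0) (by linear_combination he)
  -- `D = 2z + 1 ∈ Rˣ`, `D D' = 1`, `N = 3ϖ - z`, slope `ℓ = N D'`
  have hDu : IsUnit (2 * z + 1) := by
    rw [isUnit_iff_residue_ne_zero, map_add, map_mul, hrz, map_one]; simp
  obtain ⟨D', hDD'⟩ := hDu.exists_right_inv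
  have hrD' : residue R D' = 1 := by
    have h := congrArg (residue R) hDD'
    simp only [map_mul, map_add, map_one, hrz, mul_zero, zero_add, one_mul] at h
    exact h
  have hD'u : IsUnit D' := IsUnit.of_mul_eq_one_right _ hDD'
  obtain ⟨hyne, hslope⟩ := slope_eq_of_tangent (K := K) J h1 h2 h3 h4 (x := ϖ) (y := ϖ * z)
    (c := ϖ) (e := 3 * ϖ - z) hϖ0 hDD' (by ring) (by ring)
  obtain ⟨h₃, hadd⟩ := add_eq_some_of_slope_eq J h1 h2 h3 hQ hQ (fun h => hyne h.2) hslope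
  set ℓ : R := (3 * ϖ - z) * D' with hℓ
  -- `x(2Q₁) = ϖ² u₃`
  set X₃ : R := ℓ ^ 2 + ℓ - ϖ - ϖ with hX₃
  set U : R := 1 - ϖ * (α * ϖ ^ d + 8 * α * ϖ ^ (d + 1)) with hU
  have hDX : (2 * z + 1) ^ 2 * X₃ = ϖ ^ 2 * U := by
    have e1 : (2 * z + 1) ^ 2 * X₃ =
        (3 * ϖ - z) ^ 2 + (3 * ϖ - z) * (2 * z + 1) - (ϖ + ϖ) * (2 * z + 1) ^ 2 := by
      rw [hX₃, hℓ]
      linear_combination ((3 * ϖ - z) ^ 2 * ((2 * z + 1) * D' + 1) +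
        (3 * ϖ - z) * (2 * z + 1)) * hDD'
    rw [e1, hU]
    linear_combination (-(1 + 8 * ϖ)) * hz'
  have hUu : IsUnit U := by
    rw [isUnit_iff_residue_ne_zero, hU, map_sub, map_one, map_mul, hres0, zero_mul, sub_zero]
    exact one_ne_zero
  set u₃ : R := U * D' ^ 2 with hu₃
  have hu₃u : IsUnit u₃ := hUu.mul (hD'u.pow 2)
  have hX₃e : X₃ = ϖ ^ 2 * u₃ := by
    rw [hu₃]
    linear_combination (-(X₃ * ((2 * z + 1) * D' + 1))) * hDD' + D' ^ 2 * hDX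
  -- `y(2Q₁) = ϖ² V`, `V ∈ 𝔪`
  set Y₃ : R := -(ℓ * (X₃ - ϖ) + ϖ * z) - X₃ with hY₃
  set V : R := -(u₃ * (ℓ + 1)) + (1 - 2 * α * ϖ ^ (d + 2)) * D' with hV
  have hY₃e : Y₃ = ϖ ^ 2 * V := by
    rw [hY₃, hV, hℓ]
    linear_combination (-((3 * ϖ - z) * D' + 1)) * hX₃e - 2 * ϖ * D' * hz' + ϖ * z * hDD'
  have hVm : V ∈ maximalIdeal R := by
    rw [← residue_eq_zero_iff, hV, hu₃, hU, hℓ]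
    simp [hres0, hrz, hrD']
  obtain ⟨u₃', hu₃'⟩ := hu₃u.exists_right_inv
  have hY₃f : Y₃ = ϖ ^ 2 * u₃ * (V * u₃') := by
    rw [hY₃e]; linear_combination (-(ϖ ^ 2 * V)) * hu₃'
  refine ⟨u₃, V * u₃', ?_, hu₃u, Ideal.mul_mem_right _ _ hVm, ?_⟩
  · rw [← hY₃f, ← hX₃e]; exact h₃
  · exact hadd.trans (point_some_congr (congrArg _ hX₃e) (congrArg _ hY₃f))

/-- **`Q₁ + (πᵏu, πᵏut)` lies in the piece `v(x) = k + 1`, branch `0`.** On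
`J : y² + xy = x³ + απⁿ`, let `Q₁ = (π, πz)` with `z ∈ 𝔪` and `P = (πᵏu, πᵏut)` with `u ∈ Rˣ`,
`t ∈ 𝔪`, `2 ≤ k`, `2k + 3 ≤ n`.  Then `Q₁ + P = (πᵏ⁺¹u₃, πᵏ⁺¹u₃t₃)` with `u₃ ∈ Rˣ`,
`t₃ ∈ 𝔪`: writing `z = πζ` (`ζ ≡ 1`), `t = πt₁` (`t₁ ∈ 𝔪`), `ε = πᵏ⁻¹u`, the chord has slope
`λ = (z − εt)/(1 − ε) ∈ 𝔪` and
`(1 − ε)²·x₃ = ε(z − t)² + 2απⁿ⁻² − εαπⁿ⁻² − εαπⁿ⁻²ᵏu⁻² = πᵏ⁺¹·(uζ² + …)`,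
`y₃ = −x₃(λ + 1) + π(λ − z)`, `λ − z = πᵏu(ζ − t₁)/(1 − ε)` (cf. Silverman, *ATAEC*, V.4,
Lemma 4.1.2: `x(q u) ∈ U_{k+1}` for `u ∈ U_k` on the Tate curve). [folklore] -/
theorem add_repQ_shape (hϖ : Irreducible ϖ) (h1 : J.a₁ = 1) (h2 : J.a₂ = 0) (h3 : J.a₃ = 0)
    (h4 : J.a₄ = 0) (h6 : J.a₆ = α * ϖ ^ n) {z : R} (hz : z ∈ maximalIdeal R)
    (hQ : (J.baseChange K).toAffine.Nonsingular (algebraMap R K ϖ) (algebraMap R K (ϖ * z)))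
    {k : ℕ} (hk : 2 ≤ k) (hkn : 2 * k + 3 ≤ n) {u t : R} (hu : IsUnit u)
    (ht : t ∈ maximalIdeal R)
    (hP : (J.baseChange K).toAffine.Nonsingular (algebraMap R K (ϖ ^ k * u))
      (algebraMap R K (ϖ ^ k * u * t))) :
    ∃ (u₃ t₃ : R) (h : (J.baseChange K).toAffine.Nonsingular
        (algebraMap R K (ϖ ^ (k + 1) * u₃)) (algebraMap R K (ϖ ^ (k + 1) * u₃ * t₃))),
      IsUnit u₃ ∧ t₃ ∈ maximalIdeal R ∧
      WeierstrassCurve.Affine.Point.some _ _ hQ + WeierstrassCurve.Affine.Point.some _ _ hP =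
        WeierstrassCurve.Affine.Point.some _ _ h := by
  have hinj := IsFractionRing.injective R K
  have hϖ0 : ϖ ≠ 0 := hϖ.ne_zero
  have hm : ϖ ∈ maximalIdeal R := (IsLocalRing.mem_maximalIdeal _).mpr hϖ.not_isUnit
  obtain ⟨k₀, rfl⟩ : ∃ k₀, k = k₀ + 2 := ⟨k - 2, by omega⟩
  obtain ⟨d, rfl⟩ : ∃ d, n = 2 * k₀ + 7 + d := ⟨n - 2 * k₀ - 7, by omega⟩
  rw [show k₀ + 2 + 1 = k₀ + 3 from rfl]
  have hres0 : residue R ϖ = 0 := residue_uniformizer_eq_zero hϖ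
  -- `z = ϖ ζ`, `t = ϖ t₁`, `u w = 1`
  obtain ⟨ζ, rfl⟩ : ϖ ∣ z := (mem_maximalIdeal_iff_dvd_of_irreducible hϖ _).mp hz
  obtain ⟨t₁, rfl⟩ : ϖ ∣ t := (mem_maximalIdeal_iff_dvd_of_irreducible hϖ _).mp ht
  obtain ⟨w, huw⟩ := hu.exists_right_inv
  have hru : residue R u ≠ 0 := (isUnit_iff_residue_ne_zero _).mp hu
  -- the equation of `Q₁`
  have heQ : J.toAffine.Equation ϖ (ϖ * (ϖ * ζ)) :=
    (WeierstrassCurve.Affine.map_equation _ hinj _ _).mp hQ.left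
  rw [WeierstrassCurve.Affine.equation_iff, h1, h2, h3, h4, h6] at heQ
  have hzf : (ϖ * ζ) ^ 2 + ϖ * ζ = ϖ + α * ϖ ^ (2 * k₀ + 5 + d) :=
    mul_left_cancel₀ (pow_ne_zero 2 hϖ0) (by linear_combination heQ)
  have hζ : ϖ * ζ ^ 2 + ζ = 1 + α * ϖ ^ (2 * k₀ + 4 + d) :=
    mul_left_cancel₀ (pow_ne_zero 3 hϖ0) (by linear_combination heQ)
  have hrζ : residue R ζ = 1 := by
    have h := congrArg (residue R) hζ
    simp only [map_add, map_mul, map_pow, hres0, zero_mul, zero_add, map_one] at h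
    rw [h, zero_pow (by omega), mul_zero, add_zero]
  -- the equation of `P`
  have heP : J.toAffine.Equation (ϖ ^ (k₀ + 2) * u) (ϖ ^ (k₀ + 2) * u * (ϖ * t₁)) :=
    (WeierstrassCurve.Affine.map_equation _ hinj _ _).mp hP.left
  rw [WeierstrassCurve.Affine.equation_iff, h1, h2, h3, h4, h6] at heP
  have ht₁ : u ^ 2 * t₁ * (ϖ * t₁ + 1) = ϖ * (ϖ ^ k₀ * u ^ 3 + α * ϖ ^ (d + 1)) :=
    mul_left_cancel₀ (pow_ne_zero (2 * k₀ + 5) hϖ0) (by linear_combination heP)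
  have htf : (ϖ * t₁) ^ 2 + ϖ * t₁ = ϖ ^ (k₀ + 2) * u + α * ϖ ^ (3 + d) * w ^ 2 :=
    mul_left_cancel₀ (mul_ne_zero (pow_ne_zero (2 * k₀ + 4) hϖ0) (pow_ne_zero 2 hu.ne_zero))
      (by linear_combination heP - α * ϖ ^ (2 * k₀ + 7 + d) * (u * w + 1) * huw)
  have ht₁m : t₁ ∈ maximalIdeal R := by
    have hunit : IsUnit (u ^ 2 * (ϖ * t₁ + 1)) := by
      refine (hu.pow 2).mul ?_
      have h := isUnit_add_mul_of_isUnit hϖ isUnit_one t₁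
      rwa [add_comm] at h
    have hmem : u ^ 2 * (ϖ * t₁ + 1) * t₁ ∈ maximalIdeal R := by
      rw [show u ^ 2 * (ϖ * t₁ + 1) * t₁ = u ^ 2 * t₁ * (ϖ * t₁ + 1) by ring, ht₁]
      exact Ideal.mul_mem_right _ _ hm
    exact (Ideal.unit_mul_mem_iff_mem _ hunit).mp hmem
  have hrt₁ : residue R t₁ = 0 := (residue_eq_zero_iff _).mpr ht₁m
  -- `D = 1 - ϖ^(k₀+1) u ∈ Rˣ`, `D D' = 1`, `N = ϖ ζ - ϖ^(k₀+2) u t₁`, slope `ℓ = N D'`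
  have hDu : IsUnit (1 - ϖ ^ (k₀ + 1) * u) := by
    have h := isUnit_add_mul_of_isUnit hϖ isUnit_one (-(ϖ ^ k₀ * u))
    convert h using 1; ring
  obtain ⟨D', hDD'⟩ := hDu.exists_right_inv
  have hrD' : residue R D' = 1 := by
    have h := congrArg (residue R) hDD'
    rw [map_mul, map_sub, map_mul, map_pow, hres0, zero_pow (Nat.succ_ne_zero _), zero_mul,
      sub_zero, map_one, one_mul] at h
    exact h
  have hD'u : IsUnit D' := IsUnit.of_mul_eq_one_right _ hDD'
  obtain ⟨hxne, hslope⟩ := slope_eq_of_sub_eq (K := K) J (x₁ := ϖ) (y₁ := ϖ * (ϖ * ζ))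
    (x₂ := ϖ ^ (k₀ + 2) * u) (y₂ := ϖ ^ (k₀ + 2) * u * (ϖ * t₁)) (c := ϖ)
    (e := ϖ * ζ - ϖ ^ (k₀ + 2) * u * t₁) hϖ0 hDD' (by ring) (by ring)
  obtain ⟨h₃, hadd⟩ := add_eq_some_of_slope_eq J h1 h2 h3 hQ hP (fun h => hxne h.1) hslope
  set ℓ : R := (ϖ * ζ - ϖ ^ (k₀ + 2) * u * t₁) * D' with hℓ
  -- `x₃ = ϖ^(k₀+3) u₃`
  set X₃ : R := ℓ ^ 2 + ℓ - ϖ - ϖ ^ (k₀ + 2) * u with hX₃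
  set U : R := u * (ζ - t₁) ^ 2 +
    ϖ * (2 * α * ϖ ^ (k₀ + 1 + d) - u * α * ϖ ^ (2 * k₀ + 2 + d) - u * α * ϖ ^ d * w ^ 2)
    with hU
  have hDX : (1 - ϖ ^ (k₀ + 1) * u) ^ 2 * X₃ = ϖ ^ (k₀ + 3) * U := by
    have e1 : (1 - ϖ ^ (k₀ + 1) * u) ^ 2 * X₃ =
        (ϖ * ζ - ϖ ^ (k₀ + 2) * u * t₁) ^ 2 +
          (ϖ * ζ - ϖ ^ (k₀ + 2) * u * t₁) * (1 - ϖ ^ (k₀ + 1) * u) -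
          (ϖ + ϖ ^ (k₀ + 2) * u) * (1 - ϖ ^ (k₀ + 1) * u) ^ 2 := by
      rw [hX₃, hℓ]
      linear_combination ((ϖ * ζ - ϖ ^ (k₀ + 2) * u * t₁) ^ 2 *
        ((1 - ϖ ^ (k₀ + 1) * u) * D' + 1) +
        (ϖ * ζ - ϖ ^ (k₀ + 2) * u * t₁) * (1 - ϖ ^ (k₀ + 1) * u)) * hDD'
    rw [e1, hU]
    linear_combination (1 - ϖ ^ (k₀ + 1) * u) * hzf +
      ((ϖ ^ (k₀ + 1) * u) ^ 2 - ϖ ^ (k₀ + 1) * u) * htf +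
      α * ϖ ^ (2 * k₀ + 5 + d) * (u * w + 1) * huw
  have hUu : IsUnit U := by
    rw [isUnit_iff_residue_ne_zero, hU]
    simp only [map_add, map_sub, map_mul, map_pow, hres0, hrζ, hrt₁, zero_mul, add_zero,
      sub_zero, one_pow, mul_one]
    exact hru
  set u₃ : R := U * D' ^ 2 with hu₃
  have hu₃u : IsUnit u₃ := hUu.mul (hD'u.pow 2)
  have hX₃e : X₃ = ϖ ^ (k₀ + 3) * u₃ := by
    rw [hu₃]
    linear_combination (-(X₃ * ((1 - ϖ ^ (k₀ + 1) * u) * D' + 1))) * hDD' + D' ^ 2 * hDX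
  -- `y₃ = ϖ^(k₀+3) V`, `V ∈ 𝔪`
  set Y₃ : R := -(ℓ * (X₃ - ϖ) + ϖ * (ϖ * ζ)) - X₃ with hY₃
  set V : R := -(u₃ * (ℓ + 1)) + u * (ζ - t₁) * D' with hV
  have hY₃e : Y₃ = ϖ ^ (k₀ + 3) * V := by
    rw [hY₃, hV, hℓ]
    linear_combination (-((ϖ * ζ - ϖ ^ (k₀ + 2) * u * t₁) * D' + 1)) * hX₃e +
      ϖ ^ 2 * ζ * hDD'
  have hVm : V ∈ maximalIdeal R := by
    rw [← residue_eq_zero_iff, hV, hu₃, hU, hℓ]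
    simp [hres0, hrζ, hrt₁, hrD']
  obtain ⟨u₃', hu₃'⟩ := hu₃u.exists_right_inv
  have hY₃f : Y₃ = ϖ ^ (k₀ + 3) * u₃ * (V * u₃') := by
    rw [hY₃e]; linear_combination (-(ϖ ^ (k₀ + 3) * V)) * hu₃'
  refine ⟨u₃, V * u₃', ?_, hu₃u, Ideal.mul_mem_right _ _ hVm, ?_⟩
  · rw [← hY₃f, ← hX₃e]; exact h₃
  · exact hadd.trans (point_some_congr (congrArg _ hX₃e) (congrArg _ hY₃f))

/-! ### Cyclicity of `J(K)/J₀(K)` -/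

open _root_.WeierstrassCurve in
/-- **`E(K)/E₀(K)` is cyclic for the Tate normal form over a Henselian discrete valuation
ring.**  On `J : y² + xy = x³ + απⁿ` (`α ∈ Rˣ`, `π` a uniformiser, `n ≥ 1`) the quotient of
`J(K)` by the subgroup `E₀(K)` of points with nonsingular reduction (of order `n`,
`index_eq_of_tateNormalForm`) is cyclic: for `n ≥ 3` it is generated by the class of
`Q₁ = (π, πz)`, whose multiples `k • Q₁`, `1 ≤ k ≤ n/2`, reduce to the node (`two_smul_shape`,
`add_repQ_shape`, and the chord/tangent tests), while `k • Q₁ ≡ −(n − k) • Q₁` for `k > n/2`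
(Silverman, *ATAEC*, Cor. IV.9.2(d): "`E(K)/E₀(K)` is a cyclic group of order
`v(Δ) = −v(j)`"; on the Tate curve, V.4, the class of `k • Q₁` is the image of `πᵏ` under
`K*/qᶻ ↠ E(K)/E₀(K) ≅ ℤ/nℤ`). [cite: SilvermanATAEC1994, Cor. IV.9.2(d) (PDF p. 340)] -/
theorem isAddCyclic_quotient_of_tateNormalForm [HenselianLocalRing R] (hϖ : Irreducible ϖ)
    (h1 : J.a₁ = 1) (h2 : J.a₂ = 0) (h3 : J.a₃ = 0) (h4 : J.a₄ = 0) (hα : IsUnit α)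
    (hn : 1 ≤ n) (h6 : J.a₆ = α * ϖ ^ n) :
    IsAddCyclic ((J.baseChange K).toAffine.Point ⧸
      J.nonsingularReductionSubgroup (integers_valuationRing_valuation R K)) := by
  set H := J.nonsingularReductionSubgroup (integers_valuationRing_valuation R K) with hH
  have hidx : H.index = n := index_eq_of_tateNormalForm (K := K) J hϖ h1 h2 h3 h4 hα hn h6
  have hcard : Nat.card ((J.baseChange K).toAffine.Point ⧸ H) = n := hidx
  haveI : Finite ((J.baseChange K).toAffine.Point ⧸ H) := Nat.finite_of_card_ne_zero (by omega)
  by_cases hn3 : n < 3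
  · haveI := Fact.mk Nat.prime_two
    apply isAddCyclic_of_card_dvd_prime (p := 2)
    rw [hcard]
    interval_cases n <;> norm_num
  push Not at hn3
  have hm : ϖ ∈ maximalIdeal R := (IsLocalRing.mem_maximalIdeal _).mpr hϖ.not_isUnit
  have h3m : J.a₃ ∈ maximalIdeal R := h3 ▸ Ideal.zero_mem _
  have h4m : J.a₄ ∈ maximalIdeal R := h4 ▸ Ideal.zero_mem _
  -- the generator `Q₁ = (ϖ, ϖ z)`
  obtain ⟨z, hz, hQ⟩ := exists_repQ (K := K) J hϖ h1 h2 h3 h4 hα h6 (m := 1) le_rfl (by omega)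
  simp only [pow_one] at hQ
  have hzm : ϖ * z ∈ maximalIdeal R := Ideal.mul_mem_right _ _ hm
  -- the shapes of `k • Q₁`, `2 ≤ k < n/2`
  have key : ∀ k, 2 ≤ k → 2 * k < n → ∃ (u t : R) (h : (J.baseChange K).toAffine.Nonsingular
      (algebraMap R K (ϖ ^ k * u)) (algebraMap R K (ϖ ^ k * u * t))),
      IsUnit u ∧ t ∈ maximalIdeal R ∧ k • Affine.Point.some _ _ hQ = Affine.Point.some _ _ h := by
    intro k hk
    induction k, hk using Nat.le_induction with
    | base =>
      intro h4n
      obtain ⟨u, t, h, hu, ht, he⟩ := two_smul_shape (K := K) J hϖ h1 h2 h3 h4 h6 (by omega) hz hQ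
      exact ⟨u, t, h, hu, ht, by rw [two_nsmul, he]⟩
    | succ k hk ih =>
      intro hkn
      obtain ⟨u, t, h, hu, ht, he⟩ := ih (by omega)
      obtain ⟨u₃, t₃, h₃, hu₃, ht₃, he₃⟩ :=
        add_repQ_shape (K := K) J hϖ h1 h2 h3 h4 h6 hz hQ hk (by omega) hu ht h
      exact ⟨u₃, t₃, h₃, hu₃, ht₃, by rw [succ_nsmul', he, he₃]⟩
  -- `k • Q₁` is bad for `1 ≤ k ≤ n/2`
  have hbad : ∀ k, 1 ≤ k → 2 * k ≤ n →
      ¬ J.HasNonsingularReduction (k • Affine.Point.some _ _ hQ) := by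
    intro k hk1 hkn
    rcases Nat.lt_or_ge 1 k with hk2 | hk1'
    · rcases Nat.lt_or_ge (2 * k) n with hlt | hge
      · obtain ⟨u, t, h, -, ht, he⟩ := key k hk2 hlt
        rw [he]
        exact not_hasNonsingularReduction_some J h3m h4m
          (Ideal.mul_mem_right _ _ (Ideal.pow_mem_of_mem _ hm _ (by omega)))
          (Ideal.mul_mem_right _ _ (Ideal.mul_mem_right _ _
            (Ideal.pow_mem_of_mem _ hm _ (by omega)))) h
      · -- `2k = n`: `k • Q₁ = Q₁ + (k - 1) • Q₁`
        obtain ⟨j, rfl⟩ : ∃ j, k = j + 1 := ⟨k - 1, by omega⟩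
        rw [succ_nsmul']
        rcases Nat.lt_or_ge 1 j with hj2 | hj1
        · obtain ⟨u, t, h, hu, ht, he⟩ := key j hj2 (by omega)
          rw [he]
          obtain ⟨i, rfl⟩ : ∃ i, j = i + 2 := ⟨j - 2, by omega⟩
          refine not_hasNonsingularReduction_add_of_chord J h1 h2 h3 h4 hm
            (Ideal.mul_mem_right _ _ (Ideal.pow_mem_of_mem _ hm _ (by omega))) hzm hϖ.ne_zero
            (d := 1 - ϖ ^ (i + 1) * u) (e := z - ϖ ^ (i + 1) * u * t) ?_ ?_ ?_ (Or.inl ?_) _ _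
          · have h' := isUnit_add_mul_of_isUnit hϖ isUnit_one (-(ϖ ^ i * u))
            convert h' using 1; ring
          · ring
          · ring
          · exact Ideal.sub_mem _ hz (Ideal.mul_mem_right _ _ (Ideal.mul_mem_right _ _
              (Ideal.pow_mem_of_mem _ hm _ (Nat.succ_pos i))))
        · -- `j = 1` (`n = 4`): the tangent at `Q₁`
          obtain rfl : j = 1 := by omega
          rw [one_nsmul]
          have h2z : IsUnit (2 * z + 1) := by
            rw [isUnit_iff_residue_ne_zero, map_add, map_mul, (residue_eq_zero_iff _).mpr hz,
              mul_zero, zero_add, map_one]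
            exact one_ne_zero
          refine not_hasNonsingularReduction_two_smul_of_tangent J h1 h2 h3 h4 hm hzm hϖ.ne_zero
            h2z (e := 3 * ϖ - z) ?_ ?_ (Or.inl ?_) _
          · ring
          · ring
          · exact Ideal.sub_mem _ (Ideal.mul_mem_left _ _ hm) hz
    · obtain rfl : k = 1 := by omega
      rw [one_nsmul]
      exact not_hasNonsingularReduction_some J h3m h4m hm hzm hQ
  -- the class `g` of `Q₁` has additive order `≥ n`
  set g : (J.baseChange K).toAffine.Point ⧸ H :=
    ((Affine.Point.some _ _ hQ : (J.baseChange K).toAffine.Point) :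
      (J.baseChange K).toAffine.Point ⧸ H) with hg
  have hzero : ∀ j : ℕ, j • g = 0 →
      J.HasNonsingularReduction (j • (Affine.Point.some _ _ hQ : (J.baseChange K).toAffine.Point)) := by
    intro j hj
    rw [hg, ← QuotientAddGroup.mk_nsmul, QuotientAddGroup.eq_zero_iff] at hj
    exact hj
  have hne : ∀ k, 1 ≤ k → k < n → k • g ≠ 0 := by
    intro k hk1 hkn h0
    by_cases hk : 2 * k ≤ n
    · exact hbad k hk1 hk (hzero k h0)
    · push Not at hk
      have h' : (n - k) • g + k • g = 0 := by
        rw [← add_nsmul, Nat.sub_add_cancel hkn.le, ← hcard, card_nsmul_eq_zero']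
      rw [h0, add_zero] at h'
      exact hbad (n - k) (by omega) (by omega) (hzero _ h')
  have horder : Nat.card ((J.baseChange K).toAffine.Point ⧸ H) ≤ addOrderOf g := by
    rw [hcard]
    by_contra hlt
    push Not at hlt
    exact hne (addOrderOf g) (addOrderOf_pos g) hlt (addOrderOf_nsmul_eq_zero g)
  exact isAddCyclic_of_card_le_addOrderOf g horder

end TateNormalForm

/-! ### Transport along `R`-isomorphisms -/

/-- **Cyclicity of `E(K)/E₀(K)` does not depend on the `R`-model**: an `R`-change of variables
`D` induces `I(K) ≃+ (D • I)(K)` carrying `E₀` onto `E₀` (`hasNonsingularReduction_pointEquiv_iff`;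
Silverman, *AEC*, VII.1.3(b)), hence an isomorphism of the quotients.
[cite: SilvermanAEC2009, VII.1 Prop. 1.3(b)] -/
theorem isAddCyclic_quotient_smul_iff (I : WeierstrassCurve R)
    (D : WeierstrassCurve.VariableChange R) :
    IsAddCyclic (((D • I).baseChange K).toAffine.Point ⧸
        (D • I).nonsingularReductionSubgroup (integers_valuationRing_valuation R K)) ↔
      IsAddCyclic ((I.baseChange K).toAffine.Point ⧸
        I.nonsingularReductionSubgroup (integers_valuationRing_valuation R K)) := by
  set ψ : (I.baseChange K).toAffine.Point ≃+ ((D • I).baseChange K).toAffine.Point :=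
    (WeierstrassCurve.VariableChange.pointEquiv (I.baseChange K) (D.map (algebraMap R K))).trans
      (WeierstrassCurve.Affine.Point.congrEquiv (baseChange_smul_eq I D)) with hψ
  have hcomap : I.nonsingularReductionSubgroup (integers_valuationRing_valuation R K) =
      ((D • I).nonsingularReductionSubgroup (integers_valuationRing_valuation R K)).comap
        ψ.toAddMonoidHom := by
    ext P
    simp only [AddSubgroup.mem_comap, WeierstrassCurve.mem_nonsingularReductionSubgroup_iff]
    exact (hasNonsingularReduction_pointEquiv_iff I D P).symm
  have hmap : (I.nonsingularReductionSubgroup (integers_valuationRing_valuation R K)).map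
      ψ.toAddMonoidHom =
        (D • I).nonsingularReductionSubgroup (integers_valuationRing_valuation R K) := by
    rw [hcomap, AddSubgroup.map_comap_eq_self_of_surjective]
    exact ψ.surjective
  exact (QuotientAddGroup.congr _ _ ψ hmap).isAddCyclic.symm

end LocalIndex

end Literature.NumberTheory.EllipticCurves

/-! ### The theorem for a minimal split multiplicative equation over a Henselian ring -/

namespace WeierstrassCurve

open IsDiscreteValuationRing IsDedekindDomain.HeightOneSpectrum Polynomial
  Literature.NumberTheory.EllipticCurves

variable (R : Type*) [CommRing R] [IsDomain R] [IsDiscreteValuationRing R] {K : Type*}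
  [Field K] [Algebra R K] [IsFractionRing R K] (W : WeierstrassCurve K)

/-- **Kodaira–Néron for split multiplicative reduction over a Henselian discrete valuation ring:
`E(K)/E₀(K)` is cyclic** (Silverman, *ATAEC*, Cor. IV.9.2(d) with (b), PDF p. 340; *AEC*
Thm. VII.6.1).  For a discrete valuation ring `R`, Henselian at its maximal ideal (e.g.
complete), with fraction field `K`, and an elliptic curve over `K` given by an `R`-minimal
Weierstrass equation `W` with split multiplicative reduction, the quotient of `E(K)` by the
subgroup `E₀(K) = W.goodReductionSubgroup R` of points with nonsingular reduction is a cyclic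
group (of order `v(Δ)`, `index_goodReductionSubgroup_eq_of_hasSplitMultiplicativeReduction`).
Proof: Tate normal form of the integral model over the Henselian ring
(`exists_variableChange_eq_tateNormalForm`), invariance under `R`-isomorphisms
(`LocalIndex.isAddCyclic_quotient_smul_iff`) and
`LocalIndex.isAddCyclic_quotient_of_tateNormalForm`; no hypothesis on the residue field.
[cite: SilvermanATAEC1994, Cor. IV.9.2(d) with (b) (PDF p. 340)] -/
theorem isAddCyclic_quotient_goodReductionSubgroup_of_hasSplitMultiplicativeReduction
    [HenselianRing R (IsLocalRing.maximalIdeal R)] [W.IsElliptic]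
    [W.HasSplitMultiplicativeReduction R] :
    IsAddCyclic (W.toAffine.Point ⧸ W.goodReductionSubgroup R) := by
  -- `R` is a Henselian local ring
  haveI : HenselianLocalRing R :=
    { is_henselian := fun f hf a₀ h₁ h₂ =>
        HenselianRing.is_henselian (I := IsLocalRing.maximalIdeal R) f hf a₀ h₁ (h₂.map _) }
  -- write `W = I₀ ⊗ K` with `I₀` over `R`
  obtain ⟨I₀, hI₀⟩ : ∃ I₀ : WeierstrassCurve R, W = I₀.baseChange K := IsIntegral.integral
  subst hI₀
  have hsm : (I₀.baseChange K).HasSplitMultiplicativeReduction R := ‹_›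
  have hIm : (I₀.baseChange K).integralModel R = I₀ := integralModel_baseChange_eq R I₀
  -- hypotheses of the normal form theorem
  have hΔm : I₀.Δ ∈ IsLocalRing.maximalIdeal R := by
    have h := hsm.badReduction
    rw [← integralModel_Δ_eq R (I₀.baseChange K), hIm] at h
    exact (valuation_lt_one_iff_mem _ _).mp h
  have hc₄m : I₀.c₄ ∉ IsLocalRing.maximalIdeal R := by
    have h := hsm.multiplicativeReduction
    rw [← integralModel_c₄_eq R (I₀.baseChange K), hIm, valuation_of_algebraMap] at h
    exact intValuation_eq_one_iff.mp h
  have hsplit : ∃ μ : IsLocalRing.ResidueField R, letI Ib := I₀.map (IsLocalRing.residue R);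
      Ib.c₄ * μ ^ 2 + Ib.a₁ * Ib.c₄ * μ - (54 * Ib.b₆ - 3 * Ib.b₂ * Ib.b₄ + Ib.a₂ * Ib.c₄) = 0 := by
    have hs := hsm.splitMultiplicativeReduction
    rw [hIm] at hs
    have hc₄b : IsLocalRing.residue R I₀.c₄ ≠ 0 := by
      rw [Ne, IsLocalRing.residue_eq_zero_iff]; exact hc₄m
    have hdeg : degree (Polynomial.map (algebraMap R (IsLocalRing.ResidueField R))
        (C I₀.c₄ * X ^ 2 + C (I₀.a₁ * I₀.c₄) * X
          - C (54 * I₀.b₆ - 3 * I₀.b₂ * I₀.b₄ + I₀.a₂ * I₀.c₄))) ≠ 0 := by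
      rw [Polynomial.map_sub, Polynomial.map_add, Polynomial.map_mul, Polynomial.map_mul,
        Polynomial.map_pow, map_C, map_C, map_C, Polynomial.map_X, sub_eq_add_neg, ← C_neg,
        IsLocalRing.ResidueField.algebraMap_eq, degree_quadratic hc₄b]
      decide
    obtain ⟨μ, hμ⟩ := hs.exists_eval_eq_zero hdeg
    refine ⟨μ, ?_⟩
    rw [eval_map, IsLocalRing.ResidueField.algebraMap_eq] at hμ
    simp only [eval₂_sub, eval₂_add, eval₂_mul, eval₂_C, eval₂_X, eval₂_pow, eval₂_ofNat,
      map_mul, map_sub, map_add, map_ofNat] at hμ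
    simp only [map_c₄, map_a₁, map_a₂, map_b₂, map_b₄, map_b₆]
    exact hμ
  -- Tate normal form `J = D • I₀ : y² + xy = x³ + a`, `a = α ϖⁿ`, `n ≥ 1`
  obtain ⟨D, h1, h2, h3, h4, h6⟩ := I₀.exists_variableChange_eq_tateNormalForm hΔm hc₄m hsplit
  set J := D • I₀ with hJ
  obtain ⟨ϖ, hϖ⟩ := IsDiscreteValuationRing.exists_irreducible R
  have hI₀Δ : I₀.Δ ≠ 0 := by
    intro h0
    apply (I₀.baseChange K).isUnit_Δ.ne_zero
    change (I₀.map (algebraMap R K)).Δ = 0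
    rw [map_Δ, h0, map_zero]
  have hJΔ : J.Δ = -(J.a₆ * (1 + 432 * J.a₆)) := Δ_eq_of_tateNormalForm _ h1 h2 h3 h4
  have hJΔ' : J.Δ = ((D.u⁻¹ : Rˣ) : R) ^ 12 * I₀.Δ := variableChange_Δ _ _
  have ha0 : J.a₆ ≠ 0 := by
    intro h0
    apply hI₀Δ
    have e : ((D.u⁻¹ : Rˣ) : R) ^ 12 * I₀.Δ = 0 := by rw [← hJΔ', hJΔ, h0, zero_mul, neg_zero]
    exact ((D.u⁻¹.isUnit.pow 12).mul_right_eq_zero).mp e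
  obtain ⟨n, α, hα⟩ := eq_unit_mul_pow_irreducible ha0 hϖ
  have hn1 : 1 ≤ n := by
    rcases Nat.eq_zero_or_pos n with h0 | hpos
    · exfalso
      rw [h0, pow_zero, mul_one] at hα
      rw [hα] at h6
      exact (IsLocalRing.mem_maximalIdeal _).mp h6 α.isUnit
    · exact hpos
  -- transport to `J` and conclude
  rw [goodReductionSubgroup_baseChange_eq, ← LocalIndex.isAddCyclic_quotient_smul_iff I₀ D]
  exact LocalIndex.isAddCyclic_quotient_of_tateNormalForm (K := K) J hϖ h1 h2 h3 h4 α.isUnit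
    hn1 hα

/-- **Discharge of the named fact
`WeierstrassCurve.index_goodReductionSubgroup_of_hasSplitMultiplicativeReduction`** of
`KodairaNeron.lean` (Silverman, *ATAEC*, Cor. IV.9.2(d) with (b), PDF p. 340; *AEC*
Thm. VII.6.1): over a Henselian discrete valuation ring, for a minimal equation with split
multiplicative reduction, `E(K)/E₀(K)` is cyclic
(`isAddCyclic_quotient_goodReductionSubgroup_of_hasSplitMultiplicativeReduction`) and its order
`n = [E(K) : E₀(K)]` satisfies `v(Δ) = exp(−n)`
(`index_goodReductionSubgroup_eq_of_hasSplitMultiplicativeReduction`,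
`KodairaNeronSplitHenselianProofs.lean`); the perfectness of the residue field quantified in the
fact is not used. [cite: SilvermanATAEC1994, Cor. IV.9.2(d) with (b) (PDF p. 340)] -/
theorem index_goodReductionSubgroup_of_hasSplitMultiplicativeReduction_holds :
    W.index_goodReductionSubgroup_of_hasSplitMultiplicativeReduction R := by
  intro _ _ _ _
  exact ⟨W.isAddCyclic_quotient_goodReductionSubgroup_of_hasSplitMultiplicativeReduction R,
    (W.index_goodReductionSubgroup_eq_of_hasSplitMultiplicativeReduction R).2⟩

end WeierstrassCurve

end
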